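import Mathlib
import Summits.ValiantsHypothesis.ValiantsHypothesis.Theorems.NewtonFramesNewtonTauWeakBlockConvexThree

/-!
# `NewtonTauWeak` (stmt-ValiantsHypothesis-5904), line `low-parallelism` — the parabola dictionary (PROVED on-path honesty)

Companion of `NewtonFramesNewtonTauWeakLowParallelismCap.lean` (val-idea-12 g2; critic val-idea-crit-3 VERDICT #12, price P5).
For `A B : Finset ℝ` and non-vertical lines `L : Finset (ℝ × ℝ)` (`(μ, ν)` codes `y = μ x + ν`) the LANDINGS are the abscissae
`a + μ/2` of the incidences of `A × B` with `L`:
`(((A ×ˢ B) ×ˢ L).filter (fun q => q.1.2 = q.2.1 * q.1.1 + q.2.2)).image (fun q => q.1.1 + q.2.1 / 2)`.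

`cartesianParabolaBound_of_threeSetBound`: the hypothesis is `ThreeSetBound` of line `landing-collapse` VERBATIM (as in
`Theorems.…LandingCollapse.blockConvexBound_of_threeSetBound`, p600179); the conclusion is the Cartesian–parabola landing bound
`#landings ≤ C (n+2)^{8/3-η}` for `#A, #B ≤ n`, `#L ≤ n²`.  So the rung attacked by line `low-parallelism` is a NECESSARY sub-case of
`ThreeSetBound` (refutation value: a Cartesian product violating the landing bound refutes `ThreeSetBound`).  The map is
`Φ(x,y) = (x, y - x²)`: `P₁ = {(a,a²)}`, `P₂ = {(0,b)}`, `Y = {(μ/2, μ²/4 - ν)}`, `S = {(x,x²) : x a landing}`; for an incidence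
`b = μa + ν` one has `(a + μ/2, (a + μ/2)²) = (a,a²) + (0,b) + (μ/2, μ²/4 - ν)`, and `S` is convex independent
(`BlockConvexThree.parabola_convexIndependent`).

FRONTIER-disposition incidence geometry; VP ≠ VNP is not moved.
-/

set_option linter.dupNamespace false

open scoped BigOperators Pointwise

namespace Summit.ValiantsHypothesis.ValiantsHypothesis.Theorems.NewtonFramesNewtonTauWeak.ParabolaDictionary

/-- **THE DICTIONARY `Φ(x,y) = (x, y - x²)`.**  Hypothesis: `ThreeSetBound` of line `landing-collapse`, verbatim.  Given
`A, B, L` put `P₁ = {(a,a²)}`, `P₂ = {(0,b)}`, `Y = {(μ/2, μ²/4 - ν)}`, `S = {(x,x²) : x a landing}`: then `#Y ≤ #L`,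
`S ⊆ P₁ + P₂ + Y` (for an incidence `b = μa + ν`: `(a + μ/2, (a + μ/2)²) = (a,a²) + (0,b) + (μ/2, μ²/4 - ν)`), `S` is convex
independent (`BlockConvexThree.parabola_convexIndependent`), and `#S = #landings`. -/
theorem cartesianParabolaBound_of_threeSetBound
    (h : ∃ (η C : ℝ), 0 < η ∧
      ∀ (n : ℕ) (P₁ P₂ Y S : Finset (Fin 2 → ℝ)),
        P₁.card ≤ n → P₂.card ≤ n → Y.card ≤ n ^ 2 → S ⊆ P₁ + P₂ + Y →
          ConvexIndependent ℝ (Subtype.val : ↥(S : Set (Fin 2 → ℝ)) → (Fin 2 → ℝ)) →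
            (S.card : ℝ) ≤ C * ((n : ℝ) + 2) ^ ((8 : ℝ) / 3 - η)) :
    ∃ (η C : ℝ), 0 < η ∧ ∀ (n : ℕ) (A B : Finset ℝ) (L : Finset (ℝ × ℝ)),
      A.card ≤ n → B.card ≤ n → L.card ≤ n ^ 2 →
        (((((A ×ˢ B) ×ˢ L).filter (fun q : (ℝ × ℝ) × (ℝ × ℝ) => q.1.2 = q.2.1 * q.1.1 + q.2.2)).image
            (fun q : (ℝ × ℝ) × (ℝ × ℝ) => q.1.1 + q.2.1 / 2)).card : ℝ) ≤ C * ((n : ℝ) + 2) ^ ((8 : ℝ) / 3 - η) := by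
  classical
  obtain ⟨η, C, hη, h⟩ := h
  refine ⟨η, C, hη, ?_⟩
  intro n A B L hA hB hL
  set lanL : Finset ℝ :=
    (((A ×ˢ B) ×ˢ L).filter (fun q : (ℝ × ℝ) × (ℝ × ℝ) => q.1.2 = q.2.1 * q.1.1 + q.2.2)).image
      (fun q : (ℝ × ℝ) × (ℝ × ℝ) => q.1.1 + q.2.1 / 2) with hlanL
  set pt : ℝ → (Fin 2 → ℝ) := fun x => ![x, x ^ 2] with hpt
  set P₁ : Finset (Fin 2 → ℝ) := A.image fun a => (![a, a ^ 2] : Fin 2 → ℝ) with hP₁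
  set P₂ : Finset (Fin 2 → ℝ) := B.image fun b => (![(0 : ℝ), b] : Fin 2 → ℝ) with hP₂
  set Y : Finset (Fin 2 → ℝ) := L.image fun l => (![l.1 / 2, l.1 ^ 2 / 4 - l.2] : Fin 2 → ℝ) with hY
  set S : Finset (Fin 2 → ℝ) := lanL.image pt with hS
  have hP₁c : P₁.card ≤ n := Finset.card_image_le.trans hA
  have hP₂c : P₂.card ≤ n := Finset.card_image_le.trans hB
  have hYc : Y.card ≤ n ^ 2 := Finset.card_image_le.trans hL
  have hSsub : S ⊆ P₁ + P₂ + Y := by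
    intro s hs
    rw [hS, Finset.mem_image] at hs
    obtain ⟨x, hx, rfl⟩ := hs
    simp only [hlanL, Finset.mem_image, Finset.mem_filter, Finset.mem_product] at hx
    obtain ⟨q, ⟨⟨⟨ha, hb⟩, hl⟩, heq⟩, rfl⟩ := hx
    have hp1 : (![q.1.1, q.1.1 ^ 2] : Fin 2 → ℝ) ∈ P₁ := Finset.mem_image.2 ⟨q.1.1, ha, rfl⟩
    have hp2 : (![(0 : ℝ), q.1.2] : Fin 2 → ℝ) ∈ P₂ := Finset.mem_image.2 ⟨q.1.2, hb, rfl⟩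
    have hy : (![q.2.1 / 2, q.2.1 ^ 2 / 4 - q.2.2] : Fin 2 → ℝ) ∈ Y := Finset.mem_image.2 ⟨q.2, hl, rfl⟩
    have hsum : pt (q.1.1 + q.2.1 / 2) =
        (![q.1.1, q.1.1 ^ 2] + ![(0 : ℝ), q.1.2]) + ![q.2.1 / 2, q.2.1 ^ 2 / 4 - q.2.2] := by
      simp only [hpt]
      funext k
      fin_cases k
      · simp
      · simp only [Fin.mk_one, Fin.isValue, Matrix.cons_val_one, Pi.add_apply, Matrix.cons_val_fin_one]
        rw [heq]; ring
    rw [hsum]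
    exact Finset.add_mem_add (Finset.add_mem_add hp1 hp2) hy
  have hSconv : ConvexIndependent ℝ (Subtype.val : ↥(S : Set (Fin 2 → ℝ)) → (Fin 2 → ℝ)) := by
    refine Summit.ValiantsHypothesis.ValiantsHypothesis.Theorems.NewtonFramesNewtonTauWeak.BlockConvexThree.parabola_convexIndependent
      _ fun s hs => ?_
    obtain ⟨x, _, rfl⟩ := Finset.mem_image.1 (Finset.mem_coe.1 hs)
    simp [hpt]
  have hScard : S.card = lanL.card := by
    rw [hS]
    apply Finset.card_image_of_injective
    intro x x' hxx'
    have := congr_fun hxx' 0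
    simpa [hpt] using this
  have hmain := h n P₁ P₂ Y S hP₁c hP₂c hYc hSsub hSconv
  rw [hScard] at hmain
  exact hmain

end Summit.ValiantsHypothesis.ValiantsHypothesis.Theorems.NewtonFramesNewtonTauWeak.ParabolaDictionary
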